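import Summits.BirchSwinnertonDyer.BirchSwinnertonDyer.Theorems.ResidualThetaTransportAtTwoThetaLayerLambdaCongruenceAtTwoCuspSpanRuleQ
import Summits.BirchSwinnertonDyer.BirchSwinnertonDyer.Theorems.ResidualThetaTransportAtTwoThetaLayerLambdaCongruenceAtTwoCuspSpanQuadratic
import HarnessLib

/-!
# Route `ResidualThetaTransportAtTwo`, node 27436 `CuspSpanEvenAtTwoOdd` (cruxes Kan⁺ stmt-BirchSwinnertonDyer-20688 / Kμ⁺ 20689 /
# 21437): **the node (G′)_p = `CuspSpanEvenAtTwo p` at EVERY PRIME LEVEL `p ≠ 2`** — unconditionally, by the `q`-adic triangles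

Cell `bsd-wall`, width seat `bsd-wall-rtt-p3-w2` g4 (2026-08-28). THEOREMS ONLY (no `def`, no `sorry`, no named fact, std axioms);
`--supports stmt-BirchSwinnertonDyer-20688`. BSD is not proved by this. The item 27436 (`∀ odd N`) is NOT closed by this file:
composite and prime-power levels are not covered (the `B₁`-descent and the 4-invariance are prime-level).

THEOREM (`cuspSpanEvenAtTwo_prime`). For every prime `p ≠ 2`: every additive `χ : Γ₀(p) → ZMod 2` through the period homology
that kills every `γ` with lower-right entry `±4^k` (`k ≥ 1`) is `ψ ∘ d̄` with `ψ` multiplicative on units — `CuspSpanEvenAtTwo p`.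

PROOF (all inputs kernel theorems of this cell). Let `F(u) := χ(β_u)` on `B₁` (`…GenerationB1`). By `…CuspSpanRuleQ`
(`chi_b1_mul_prime_pow`): `F(qv) = F(q) + F(v)` for every odd prime `q ≠ p` and every unit `v`. The set of `x` with
`F(xv) = F(x) + F(v) ∀v` is closed under products (§1) and contains `1` and every odd prime `≠ p`; every unit class mod `p` has an
odd representative `< 2p` prime to `p`, a product of such primes (§2, induction on `Nat.minFac`). So `F` is multiplicative (§3).
ASSEMBLY (§4, pattern of `cuspSpanTrace_of_quadratic_certificate`): `ψ := F` (`ψ(0) := 0`); `χ + ψ∘d̄` is additive, kills the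
small-trace elements (`d̄ = ±1` or an elliptic residue: `F = 0` by `K(±1)`, `K_ell`) and every `b = −1` element, hence vanishes by
the descent `chi_eq_zero_of_forall_b1`; so `χ = ψ ∘ d̄`, and `cuspSpanEvenAtTwo_of_cuspSpanTrace` gives the node.

CONSEQUENCES (by the cell's landed closers, modulo their print binders): FLAT / item 21437 / Kan⁺ / TP2-K1 for every habitat⁺ curve
of PRIME conductor; Pollack's `μ⁻ = 0` at `p = 2` reading for prime level (w3 g6 memo §7) — see the seat memo `Lines/birth-triangles.md`.

References: P. G. L. Dirichlet (1837) / Mathlib `PrimesInAP`; H. Rademacher, Abh. Math. Sem. Hamburg 7 (1929) §1 [Rademacher1929];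
A. W. Knapp, *Elliptic curves* (1992) Prop. 11.1 [Knapp1993]; R. Pollack, Duke Math. J. 118 (2003) Conj. 6.3 [Pollack2003].
-/

set_option autoImplicit false
set_option linter.dupNamespace false

open scoped MatrixGroups

open CongruenceSubgroup

namespace Summit.BirchSwinnertonDyer.BirchSwinnertonDyer.Theorems.SignedMuAtTwo

section PrimeLevel

variable {p : ℕ} [Fact p.Prime] {χ : Gamma0 p → ZMod 2}

/-! ## §1. The multiplicative residues of `F` form a monoid containing the odd primes `≠ p` -/

/-- `1` is multiplicative for `F`: `F(1·v) = F(1) + F(v)` (`F(1) = 0`). [folklore] -/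
theorem b1_mul_one (hadd : ∀ γ δ : Gamma0 p, χ (γ * δ) = χ γ + χ δ)
    (hsmall : ∀ γ : Gamma0 p, ((γ : SL(2, ℤ)) 0 0 + (γ : SL(2, ℤ)) 1 1).natAbs ≤ 2 → χ γ = 0) :
    ∀ βx βv βw : Gamma0 p, (βx : SL(2, ℤ)) 0 1 = -1 → (βv : SL(2, ℤ)) 0 1 = -1 → (βw : SL(2, ℤ)) 0 1 = -1 →
      ((((βx : SL(2, ℤ)) 1 1 : ℤ) : ZMod p)) = 1 →
      ((((βw : SL(2, ℤ)) 1 1 : ℤ) : ZMod p)) = 1 * ((((βv : SL(2, ℤ)) 1 1 : ℤ) : ZMod p)) →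
      χ βw = χ βx + χ βv := by
  intro βx βv βw hbx hbv hbw hx hw
  rw [one_mul] at hw
  rw [chi_eq_zero_of_b_neg_one_of_d_one hadd hsmall βx hbx hx, zero_add,
    chi_eq_of_apply_zero_one_eq_neg_one hadd hsmall hbw hbv hw]

/-- Closure under products: if `x` and `y` are multiplicative for `F` then so is `xy`. [folklore] -/
theorem b1_mul_mul {x y : ZMod p} (hxu : IsUnit x) (hyu : IsUnit y)
    (hX : ∀ βx βv βw : Gamma0 p, (βx : SL(2, ℤ)) 0 1 = -1 → (βv : SL(2, ℤ)) 0 1 = -1 → (βw : SL(2, ℤ)) 0 1 = -1 →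
      ((((βx : SL(2, ℤ)) 1 1 : ℤ) : ZMod p)) = x →
      ((((βw : SL(2, ℤ)) 1 1 : ℤ) : ZMod p)) = x * ((((βv : SL(2, ℤ)) 1 1 : ℤ) : ZMod p)) →
      χ βw = χ βx + χ βv)
    (hY : ∀ βx βv βw : Gamma0 p, (βx : SL(2, ℤ)) 0 1 = -1 → (βv : SL(2, ℤ)) 0 1 = -1 → (βw : SL(2, ℤ)) 0 1 = -1 →
      ((((βx : SL(2, ℤ)) 1 1 : ℤ) : ZMod p)) = y →
      ((((βw : SL(2, ℤ)) 1 1 : ℤ) : ZMod p)) = y * ((((βv : SL(2, ℤ)) 1 1 : ℤ) : ZMod p)) →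
      χ βw = χ βx + χ βv) :
    ∀ βx βv βw : Gamma0 p, (βx : SL(2, ℤ)) 0 1 = -1 → (βv : SL(2, ℤ)) 0 1 = -1 → (βw : SL(2, ℤ)) 0 1 = -1 →
      ((((βx : SL(2, ℤ)) 1 1 : ℤ) : ZMod p)) = x * y →
      ((((βw : SL(2, ℤ)) 1 1 : ℤ) : ZMod p)) = x * y * ((((βv : SL(2, ℤ)) 1 1 : ℤ) : ZMod p)) →
      χ βw = χ βx + χ βv := by
  intro βxy βv βw hbxy hbv hbw hxy hw
  obtain ⟨βx', hbx', hdx'⟩ := exists_b_neg_one_of_isUnit (N := p) hxu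
  obtain ⟨βy', hby', hdy'⟩ := exists_b_neg_one_of_isUnit (N := p) hyu
  obtain ⟨βyv, hbyv, hdyv⟩ := exists_b_neg_one_of_isUnit (N := p) (hyu.mul (isUnit_gamma0_apply_one_one βv))
  have h1 : χ βyv = χ βy' + χ βv := hY βy' βv βyv hby' hbv hbyv hdy' hdyv
  have h2 : χ βw = χ βx' + χ βyv := hX βx' βyv βw hbx' hbyv hbw hdx' (by rw [hw, hdyv, mul_assoc])
  have h3 : χ βxy = χ βx' + χ βy' := hX βx' βy' βxy hbx' hby' hbxy hdx' (by rw [hxy, hdy'])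
  rw [h2, h1, h3]; ring

/-- Every odd prime `q ≠ p` is multiplicative for `F` (`…CuspSpanRuleQ`, `j = 1`). [cite: Pollack2003, Conj. 6.3] -/
theorem b1_mul_odd_prime (hp2 : p ≠ 2)
    (hadd : ∀ γ δ : Gamma0 p, χ (γ * δ) = χ γ + χ δ)
    (hsmall : ∀ γ : Gamma0 p, ((γ : SL(2, ℤ)) 0 0 + (γ : SL(2, ℤ)) 1 1).natAbs ≤ 2 → χ γ = 0)
    (hkill : ∀ γ : Gamma0 p, (∃ k : ℕ, 1 ≤ k ∧ ((γ : SL(2, ℤ)) 1 1).natAbs = 4 ^ k) → χ γ = 0)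
    (q : ℕ) (hq : q.Prime) (hq2 : q ≠ 2) (hqp : q ≠ p) :
    ∀ βx βv βw : Gamma0 p, (βx : SL(2, ℤ)) 0 1 = -1 → (βv : SL(2, ℤ)) 0 1 = -1 → (βw : SL(2, ℤ)) 0 1 = -1 →
      ((((βx : SL(2, ℤ)) 1 1 : ℤ) : ZMod p)) = (q : ZMod p) →
      ((((βw : SL(2, ℤ)) 1 1 : ℤ) : ZMod p)) = (q : ZMod p) * ((((βv : SL(2, ℤ)) 1 1 : ℤ) : ZMod p)) →
      χ βw = χ βx + χ βv := by
  intro βx βv βw hbx hbv hbw hx hw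
  exact chi_b1_mul_prime_pow hp2 hadd hsmall hkill q hq hq2 hqp 1 hbx hbv hbw (by rw [hx, pow_one])
    (by rw [hw, pow_one])

/-! ## §2. Generation: every unit class is a product of odd primes `≠ p` -/

/-- Every odd natural number prime to `p` is multiplicative for `F` (induction on the least prime factor). [folklore] -/
theorem b1_mul_odd_nat (hp2 : p ≠ 2)
    (hadd : ∀ γ δ : Gamma0 p, χ (γ * δ) = χ γ + χ δ)
    (hsmall : ∀ γ : Gamma0 p, ((γ : SL(2, ℤ)) 0 0 + (γ : SL(2, ℤ)) 1 1).natAbs ≤ 2 → χ γ = 0)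
    (hkill : ∀ γ : Gamma0 p, (∃ k : ℕ, 1 ≤ k ∧ ((γ : SL(2, ℤ)) 1 1).natAbs = 4 ^ k) → χ γ = 0) :
    ∀ m : ℕ, m % 2 = 1 → ¬ p ∣ m →
      ∀ βx βv βw : Gamma0 p, (βx : SL(2, ℤ)) 0 1 = -1 → (βv : SL(2, ℤ)) 0 1 = -1 → (βw : SL(2, ℤ)) 0 1 = -1 →
        ((((βx : SL(2, ℤ)) 1 1 : ℤ) : ZMod p)) = (m : ZMod p) →
        ((((βw : SL(2, ℤ)) 1 1 : ℤ) : ZMod p)) = (m : ZMod p) * ((((βv : SL(2, ℤ)) 1 1 : ℤ) : ZMod p)) →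
        χ βw = χ βx + χ βv := by
  have hp : p.Prime := Fact.out
  intro m
  induction m using Nat.strong_induction_on with
  | _ m ih =>
    intro hmodd hpm
    by_cases hm1 : m = 1
    · subst hm1
      intro βx βv βw hbx hbv hbw hx hw
      exact b1_mul_one hadd hsmall βx βv βw hbx hbv hbw (by rw [hx, Nat.cast_one]) (by rw [hw, Nat.cast_one])
    · have hm0 : m ≠ 0 := by intro h; rw [h] at hmodd; norm_num at hmodd
      set q := m.minFac with hq
      have hqprime : q.Prime := Nat.minFac_prime hm1
      have hqm : q ∣ m := Nat.minFac_dvd m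
      obtain ⟨m', hm'⟩ := hqm
      have hq2 : q ≠ 2 := by
        intro h2; rw [h2] at hm'; omega
      have hqp : q ≠ p := by
        intro hqp; apply hpm; rw [← hqp, hm']; exact dvd_mul_right _ _
      have hm'lt : m' < m := by
        have hq2' : 2 ≤ q := hqprime.two_le
        rcases Nat.eq_zero_or_pos m' with h0 | h0
        · rw [h0, mul_zero] at hm'; exact absurd hm' hm0
        · nlinarith
      have hm'odd : m' % 2 = 1 := by
        by_contra h
        have : 2 ∣ m := by rw [hm']; exact Dvd.dvd.mul_left (Nat.dvd_of_mod_eq_zero (by omega)) q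
        omega
      have hpm' : ¬ p ∣ m' := fun h ↦ hpm (by rw [hm']; exact Dvd.dvd.mul_left h q)
      have hM' := ih m' hm'lt hm'odd hpm'
      have hQ := b1_mul_odd_prime hp2 hadd hsmall hkill q hqprime hq2 hqp
      have hqu : IsUnit (q : ZMod p) := by
        rw [isUnit_iff_ne_zero]; intro h0
        exact hqp ((Nat.prime_dvd_prime_iff_eq hp hqprime).mp ((ZMod.natCast_eq_zero_iff q p).mp h0)).symm
      have hm'u : IsUnit (m' : ZMod p) := by
        rw [isUnit_iff_ne_zero]; intro h0
        exact hpm' ((ZMod.natCast_eq_zero_iff m' p).mp h0)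
      have hprod := b1_mul_mul hqu hm'u hQ hM'
      intro βx βv βw hbx hbv hbw hx hw
      have hcast : (m : ZMod p) = (q : ZMod p) * (m' : ZMod p) := by rw [hm']; push_cast; ring
      exact hprod βx βv βw hbx hbv hbw (by rw [hx, hcast]) (by rw [hw, hcast])

/-- **`F` is multiplicative on all units** of `ZMod p` (`p` an odd prime): every unit class has an odd representative `< 2p`
prime to `p`. [cite: Pollack2003, Conj. 6.3] -/
theorem b1_mul_all (hp2 : p ≠ 2)
    (hadd : ∀ γ δ : Gamma0 p, χ (γ * δ) = χ γ + χ δ)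
    (hsmall : ∀ γ : Gamma0 p, ((γ : SL(2, ℤ)) 0 0 + (γ : SL(2, ℤ)) 1 1).natAbs ≤ 2 → χ γ = 0)
    (hkill : ∀ γ : Gamma0 p, (∃ k : ℕ, 1 ≤ k ∧ ((γ : SL(2, ℤ)) 1 1).natAbs = 4 ^ k) → χ γ = 0)
    (x : ZMod p) (hx0 : x ≠ 0) :
    ∀ βx βv βw : Gamma0 p, (βx : SL(2, ℤ)) 0 1 = -1 → (βv : SL(2, ℤ)) 0 1 = -1 → (βw : SL(2, ℤ)) 0 1 = -1 →
      ((((βx : SL(2, ℤ)) 1 1 : ℤ) : ZMod p)) = x →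
      ((((βw : SL(2, ℤ)) 1 1 : ℤ) : ZMod p)) = x * ((((βv : SL(2, ℤ)) 1 1 : ℤ) : ZMod p)) →
      χ βw = χ βx + χ βv := by
  have hp : p.Prime := Fact.out
  have hpodd : p % 2 = 1 := Nat.odd_iff.mp (hp.eq_two_or_odd'.resolve_left hp2)
  have hval0 : x.val ≠ 0 := fun h ↦ hx0 ((ZMod.val_eq_zero x).mp h)
  have hvallt : x.val < p := ZMod.val_lt x
  have hpval : ¬ p ∣ x.val := fun h ↦ hval0 (Nat.eq_zero_of_dvd_of_lt h hvallt)
  by_cases hodd : x.val % 2 = 1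
  · have h := b1_mul_odd_nat hp2 hadd hsmall hkill x.val hodd hpval
    rw [ZMod.natCast_zmod_val] at h
    exact h
  · have hodd' : (x.val + p) % 2 = 1 := by omega
    have hpval' : ¬ p ∣ x.val + p := fun h ↦ hpval ((Nat.dvd_add_left (dvd_refl p)).mp h)
    have h := b1_mul_odd_nat hp2 hadd hsmall hkill (x.val + p) hodd' hpval'
    rw [Nat.cast_add, ZMod.natCast_zmod_val, ZMod.natCast_self, add_zero] at h
    exact h

/-! ## §3–§4. Assembly: the node at every prime level -/

/-- **(G″)_p at every odd prime level**: an additive `χ : Γ₀(p) → ZMod 2` killing the small-trace elements and the `4^k`-classes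
is `ψ ∘ d̄` with `ψ` multiplicative on units (`ψ = F`). [cite: Pollack2003, Conj. 6.3] [cite: Rademacher1929, §1] -/
theorem cuspSpanTrace_prime (hp2 : p ≠ 2) : ∀ χ : Gamma0 p → ZMod 2,
    (∀ γ δ : Gamma0 p, χ (γ * δ) = χ γ + χ δ) →
    (∀ γ : Gamma0 p, ((γ : SL(2, ℤ)) 0 0 + (γ : SL(2, ℤ)) 1 1).natAbs ≤ 2 → χ γ = 0) →
    (∀ γ : Gamma0 p, (∃ k : ℕ, 1 ≤ k ∧ ((γ : SL(2, ℤ)) 1 1).natAbs = 4 ^ k) → χ γ = 0) →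
    ∃ ψ : ZMod p → ZMod 2, (∀ x y : ZMod p, IsUnit x → IsUnit y → ψ (x * y) = ψ x + ψ y) ∧
      ∀ γ : Gamma0 p, χ γ = ψ ((((γ : SL(2, ℤ)) 1 1 : ℤ) : ZMod p)) := by
  classical
  intro χ hadd hsmall hkill
  have hp : p.Prime := Fact.out
  -- `ψ := F`, through a chosen `b = −1` representative of each unit class
  let ψ : ZMod p → ZMod 2 := fun x ↦
    if h : IsUnit x then χ (Classical.choose (exists_b_neg_one_of_isUnit (N := p) h)) else 0
  have hψF : ∀ β : Gamma0 p, (β : SL(2, ℤ)) 0 1 = -1 → ψ ((((β : SL(2, ℤ)) 1 1 : ℤ) : ZMod p)) = χ β := by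
    intro β hb
    have hu := isUnit_gamma0_apply_one_one β
    simp only [ψ, dif_pos hu]
    obtain ⟨hb₀, hd₀⟩ := Classical.choose_spec (exists_b_neg_one_of_isUnit (N := p) hu)
    exact chi_eq_of_apply_zero_one_eq_neg_one hadd hsmall hb₀ hb hd₀
  have hψmul : ∀ x y : ZMod p, IsUnit x → IsUnit y → ψ (x * y) = ψ x + ψ y := by
    intro x y hx hy
    obtain ⟨βx, hbx, hdx⟩ := exists_b_neg_one_of_isUnit (N := p) hx
    obtain ⟨βy, hby, hdy⟩ := exists_b_neg_one_of_isUnit (N := p) hy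
    obtain ⟨βxy, hbxy, hdxy⟩ := exists_b_neg_one_of_isUnit (N := p) (hx.mul hy)
    rw [← hdxy, hψF βxy hbxy, ← hdx, hψF βx hbx, ← hdy, hψF βy hby]
    exact b1_mul_all hp2 hadd hsmall hkill x hx.ne_zero βx βy βxy hbx hby hbxy hdx (by rw [hdxy, hdy])
  -- the corrected character `χ' = χ + ψ ∘ d̄`
  let χ' : Gamma0 p → ZMod 2 := fun γ ↦ χ γ + ψ ((((γ : SL(2, ℤ)) 1 1 : ℤ) : ZMod p))
  have hadd' : ∀ γ δ : Gamma0 p, χ' (γ * δ) = χ' γ + χ' δ := by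
    intro γ δ
    simp only [χ']
    rw [cast_mul_apply_one_one, hψmul _ _ (isUnit_gamma0_apply_one_one γ) (isUnit_gamma0_apply_one_one δ), hadd]
    ring
  have hsmall' : ∀ γ : Gamma0 p, ((γ : SL(2, ℤ)) 0 0 + (γ : SL(2, ℤ)) 1 1).natAbs ≤ 2 → χ' γ = 0 := by
    intro γ ht
    simp only [χ']
    rw [hsmall γ ht, zero_add]
    -- `d̄(γ)` is `±1` or an elliptic residue: `F = 0` there
    have hu := isUnit_gamma0_apply_one_one γ
    obtain ⟨β, hb, hd⟩ := exists_b_neg_one_of_isUnit (N := p) hu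
    rw [← hd, hψF β hb]
    set d : ℤ := (γ : SL(2, ℤ)) 1 1 with hdd
    set t : ℤ := (γ : SL(2, ℤ)) 0 0 + (γ : SL(2, ℤ)) 1 1 with htdef
    have hsq : ((d : ℤ) : ZMod p) * ((d : ℤ) : ZMod p) = (t : ZMod p) * ((d : ℤ) : ZMod p) - 1 :=
      cast_apply_one_one_sq γ
    have hcases : t = -2 ∨ t = -1 ∨ t = 0 ∨ t = 1 ∨ t = 2 := by omega
    rcases hcases with h | h | h | h | h
    · -- `d̄ = −1`
      rw [h] at hsq; push_cast at hsq
      have : (((d : ℤ) : ZMod p) + 1) * (((d : ℤ) : ZMod p) + 1) = 0 := by linear_combination hsq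
      have hd1 : ((d : ℤ) : ZMod p) = -1 := by
        rcases mul_eq_zero.mp this with h1 | h1 <;> linear_combination h1
      exact chi_eq_zero_of_b_neg_one_of_d_neg_one hadd hsmall β hb (by rw [hd, hd1])
    · exact chi_eq_zero_of_b_neg_one_of_elliptic hadd hsmall β hb d 1 (by norm_num)
        ((ZMod.intCast_zmod_eq_zero_iff_dvd _ p).mp (by push_cast; rw [h] at hsq; push_cast at hsq; linear_combination hsq)) hd
    · exact chi_eq_zero_of_b_neg_one_of_elliptic hadd hsmall β hb d 0 (by norm_num)
        ((ZMod.intCast_zmod_eq_zero_iff_dvd _ p).mp (by push_cast; rw [h] at hsq; push_cast at hsq; linear_combination hsq)) hd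
    · exact chi_eq_zero_of_b_neg_one_of_elliptic hadd hsmall β hb d (-1) (by norm_num)
        ((ZMod.intCast_zmod_eq_zero_iff_dvd _ p).mp (by push_cast; rw [h] at hsq; push_cast at hsq; linear_combination hsq)) hd
    · -- `d̄ = 1`
      rw [h] at hsq; push_cast at hsq
      have : (((d : ℤ) : ZMod p) - 1) * (((d : ℤ) : ZMod p) - 1) = 0 := by linear_combination hsq
      have hd1 : ((d : ℤ) : ZMod p) = 1 := by
        rcases mul_eq_zero.mp this with h1 | h1 <;> linear_combination h1
      exact chi_eq_zero_of_b_neg_one_of_d_one hadd hsmall β hb (by rw [hd, hd1])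
  have hB' : ∀ β : Gamma0 p, (β : SL(2, ℤ)) 0 1 = -1 → χ' β = 0 := by
    intro β hb
    simp only [χ']
    rw [hψF β hb]
    exact CharTwo.add_self_eq_zero _
  have hsucc : ∀ δ : ℤ, IsUnit ((δ : ℤ) : ZMod p) ∨ IsUnit (((δ + 1 : ℤ)) : ZMod p) := by
    intro δ
    by_contra hcon
    push Not at hcon
    obtain ⟨h1, h2⟩ := hcon
    rw [isUnit_iff_ne_zero, not_not] at h1 h2
    push_cast at h2
    rw [h1, zero_add] at h2
    exact one_ne_zero h2
  have hzero := chi_eq_zero_of_forall_b1 hsucc hadd' hsmall' (forall_b1_of_forall_b_neg_one hadd' hB')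
  refine ⟨ψ, hψmul, fun γ ↦ ?_⟩
  have h := hzero γ
  simp only [χ'] at h
  have e : χ γ = -ψ ((((γ : SL(2, ℤ)) 1 1 : ℤ) : ZMod p)) := by linear_combination h
  rw [e, ZMod.neg_eq_self_mod_two]

/-- **THE NODE AT EVERY PRIME LEVEL: `CuspSpanEvenAtTwo p` for every prime `p ≠ 2`** (the even `2`-power cusp classes span the
kernel of the Shimura-quotient map on `H₁(X₀(p); 𝔽₂)`). Unconditional; inputs: Dirichlet's theorem (Mathlib), quadratic
reciprocity (Mathlib), Hensel lifting for `4` mod `q^t`, the triangle lemma, the `B₁`-descent. [cite: Pollack2003, Conj. 6.3] -/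
theorem cuspSpanEvenAtTwo_prime (hp2 : p ≠ 2) : CuspSpanEvenAtTwo p :=
  cuspSpanEvenAtTwo_of_cuspSpanTrace (cuspSpanTrace_prime hp2)

/-- The node at every odd prime level, with the primality as an explicit hypothesis. [cite: Pollack2003, Conj. 6.3] -/
theorem cuspSpanEvenAtTwo_of_prime {ℓ : ℕ} (hℓ : ℓ.Prime) (hℓ2 : ℓ ≠ 2) :
    haveI : NeZero ℓ := ⟨hℓ.ne_zero⟩
    CuspSpanEvenAtTwo ℓ := by
  haveI : Fact ℓ.Prime := ⟨hℓ⟩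
  exact cuspSpanEvenAtTwo_prime hℓ2

end PrimeLevel

end Summit.BirchSwinnertonDyer.BirchSwinnertonDyer.Theorems.SignedMuAtTwo
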